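import Mathlib
import Literature.Analysis.FluidPDE.VectorCalculus

/-!
# Route `FilamentSkeletonRss` · child crux `TangentSkeletonNearStraightL` (stmt-NavierStokesRegularity-23320) · registered line
# `child_tangent_analytic_strip_L` (b0b56c52900dd90a), stub `stub_stripPropagation` — bricks: THE COMPLEXIFIED MATCHED KERNEL

The matched Biot–Savart integrand of the stub is `((‖y−Z‖² + κ·A)^{3/2})⁻¹ • (Z′ × (y − Z))`.  Its analytic continuation along the stadium replaces the
real base `‖y−Z‖² + κ·A > 0` by a complex number `w` of POSITIVE REAL PART (principal branch: `Theorems.StadiumVerticalDisplacement`,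
`Theorems.StadiumChord`) and the real cross product by the bilinear one on `ℂ³`.  This file supplies the two elementary pieces (R1/R3 of the
STUB-PLAN memo attached to 23320):
* `differentiableAt_inv_cpow_threeHalves`, `norm_inv_cpow_threeHalves`, `norm_inv_cpow_threeHalves_le`, `inv_cpow_threeHalves_ofReal` — the power
  `w ↦ (w^{3/2})⁻¹` is holomorphic on `Re w > 0`, has modulus `‖w‖^{-3/2} ≤ (Re w)^{-3/2}`, and agrees with the real kernel at positive reals;
* `cplx_cross`, `norm_crossProduct_le` — the complexified cross product: `cplx (cross a b) = cplx a ⨯₃ cplx b` (Mathlib's `crossProduct` over `ℂ`,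
  `Literature.Analysis.FluidPDE.cross` on the real side) and the sup-norm bound `‖u ⨯₃ v‖ ≤ 2‖u‖‖v‖` on `ℂ³`.
HONEST FRAMING: bricks for a plan about a HYPOTHETICAL filament skeleton on the NEGATIVE side of a MODEL route; the stub `stub_stripPropagation` is
NOT closed; nothing here bears on Navier–Stokes regularity or blow-up.  `--supports stmt-NavierStokesRegularity-23320`.
-/

set_option linter.dupNamespace false

noncomputable section

namespace Summit.NavierStokesRegularity.NavierStokesRegularity.Theorems.StadiumKernelPieces

open Set Filter Topology Complex
open scoped InnerProductSpace Matrix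

/-! ## The principal-branch power `(w^{3/2})⁻¹` on the right half-plane -/

/-- `w ↦ (w^{3/2})⁻¹` is complex-differentiable at every `w` with `0 < Re w`. [folklore] -/
theorem differentiableAt_inv_cpow_threeHalves {w : ℂ} (hw : 0 < w.re) :
    DifferentiableAt ℂ (fun w : ℂ => (w ^ ((3:ℂ) / 2))⁻¹) w := by
  have hslit : w ∈ slitPlane := by rw [slitPlane_eq_union]; exact Or.inl hw
  have hne : w ^ ((3:ℂ) / 2) ≠ 0 := by
    rw [Ne, cpow_eq_zero_iff, not_and_or]
    left
    intro h; rw [h] at hw; simp at hw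
  exact (differentiableAt_id.cpow_const hslit).inv hne

/-- `w ↦ (w^{3/2})⁻¹` is complex-differentiable on the right half-plane. [folklore] -/
theorem differentiableOn_inv_cpow_threeHalves :
    DifferentiableOn ℂ (fun w : ℂ => (w ^ ((3:ℂ) / 2))⁻¹) {w : ℂ | 0 < w.re} := fun _ hw =>
  (differentiableAt_inv_cpow_threeHalves hw).differentiableWithinAt

/-- Modulus of the principal-branch power: `‖(w^{3/2})⁻¹‖ = ‖w‖^{−3/2}` for `w ≠ 0`. [folklore] -/
theorem norm_inv_cpow_threeHalves {w : ℂ} (hw : w ≠ 0) :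
    ‖(w ^ ((3:ℂ) / 2))⁻¹‖ = ‖w‖ ^ (-(3/2 : ℝ)) := by
  rw [norm_inv, norm_cpow_of_ne_zero hw]
  have him : ((3:ℂ) / 2).im = 0 := by norm_num
  have hre : ((3:ℂ) / 2).re = 3 / 2 := by norm_num
  rw [him, hre, mul_zero, Real.exp_zero, div_one, Real.rpow_neg (norm_nonneg w)]

/-- On `Re w > 0`: `‖(w^{3/2})⁻¹‖ ≤ (Re w)^{−3/2}`. [folklore] -/
theorem norm_inv_cpow_threeHalves_le {w : ℂ} (hw : 0 < w.re) :
    ‖(w ^ ((3:ℂ) / 2))⁻¹‖ ≤ w.re ^ (-(3/2 : ℝ)) := by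
  have hne : w ≠ 0 := by intro h; rw [h] at hw; simp at hw
  rw [norm_inv_cpow_threeHalves hne]
  exact Real.rpow_le_rpow_of_nonpos hw (Complex.re_le_norm w) (by norm_num)

/-- Agreement with the real kernel at positive reals: `((t:ℂ)^{3/2})⁻¹ = ((t^{3/2})⁻¹ : ℝ)`. [folklore] -/
theorem inv_cpow_threeHalves_ofReal {t : ℝ} (ht : 0 ≤ t) :
    (((t : ℂ)) ^ ((3:ℂ) / 2))⁻¹ = (((t ^ (3/2 : ℝ))⁻¹ : ℝ) : ℂ) := by
  rw [Complex.ofReal_inv, Complex.ofReal_cpow ht]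
  norm_num

/-! ## The complexified cross product -/

/-- The complexification `(⟪·, eᵢ⟫)ᵢ` of the real cross product `Literature.Analysis.FluidPDE.cross a b` is the bilinear cross product of the
complexifications (Mathlib's `crossProduct` over `ℂ`). [folklore] -/
theorem cplx_cross (a b : EuclideanSpace ℝ (Fin 3)) :
    (fun i => ((⟪Literature.Analysis.FluidPDE.cross a b, EuclideanSpace.single i (1:ℝ)⟫_ℝ : ℝ) : ℂ)) =
      (fun i => ((⟪a, EuclideanSpace.single i (1:ℝ)⟫_ℝ : ℝ) : ℂ)) ⨯₃ (fun i => ((⟪b, EuclideanSpace.single i (1:ℝ)⟫_ℝ : ℝ) : ℂ)) := by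
  funext i
  simp only [EuclideanSpace.inner_single_right, one_mul, conj_trivial]
  rw [cross_apply, Literature.Analysis.FluidPDE.cross, cross_apply]
  fin_cases i <;> simp

/-- Sup-norm bound for the bilinear cross product on `ℂ³`: `‖u ⨯₃ v‖ ≤ 2‖u‖‖v‖`. [folklore] -/
theorem norm_crossProduct_le (u v : Fin 3 → ℂ) : ‖u ⨯₃ v‖ ≤ 2 * ‖u‖ * ‖v‖ := by
  have hu : ∀ i, ‖u i‖ ≤ ‖u‖ := fun i => norm_le_pi_norm u i
  have hv : ∀ i, ‖v i‖ ≤ ‖v‖ := fun i => norm_le_pi_norm v i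
  have hterm : ∀ i j k l : Fin 3, ‖u i * v j - u k * v l‖ ≤ 2 * ‖u‖ * ‖v‖ := by
    intro i j k l
    calc ‖u i * v j - u k * v l‖ ≤ ‖u i * v j‖ + ‖u k * v l‖ := norm_sub_le _ _
      _ = ‖u i‖ * ‖v j‖ + ‖u k‖ * ‖v l‖ := by rw [norm_mul, norm_mul]
      _ ≤ ‖u‖ * ‖v‖ + ‖u‖ * ‖v‖ := add_le_add (mul_le_mul (hu i) (hv j) (norm_nonneg _) (norm_nonneg _))
          (mul_le_mul (hu k) (hv l) (norm_nonneg _) (norm_nonneg _))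
      _ = 2 * ‖u‖ * ‖v‖ := by ring
  refine (pi_norm_le_iff_of_nonneg (by positivity)).2 fun i => ?_
  rw [cross_apply]
  fin_cases i
  · exact hterm 1 2 2 1
  · exact hterm 2 0 0 2
  · exact hterm 0 1 1 0

end Summit.NavierStokesRegularity.NavierStokesRegularity.Theorems.StadiumKernelPieces

end
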